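import Summits.QuantumFields.YangMills.Theses.QuantileBitPurity
import Summits.QuantumFields.YangMills.Theorems.QuantileBitPurityBitPersistence
import HarnessLib

/-!
# DOOR `QuantileBitPurity.QuantileBitDoor` (item stmt-QuantumFields-23925): a quantile of the Polyakov holonomy off the core plus Lévy
# anti-concentration above the core force a purity deficit `Z_phys(2L) ≤ (1 − β⁻¹) Z_phys(L)²` on a window `L ≤ β^a`

LINE g12-B of seat ym-idea-4 (route `QuantileBitPurity`, target leaf `ThermalTraceWindow.SubFemtoTraceRatio` = K2, stmt-QuantumFields-28257).  We prove
the route's support item THE DOOR by name: `HolonomyQuantileOffCore → HolonomyLevyWindow → ∃ a > 0, ∃ k β₀ L₀, ∀ β ≥ β₀, ∀ L₀ ≤ L ≤ β^a,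
Z_phys(2L) ≤ (1 − β^{−k}) Z_phys(L)²` (with `k = 1`, `a = min(a₁, a₀/2)` from the window exponents of the two hypotheses).

Mechanism (a two-time trace computed two ways and split by levels; no entropy factor, no `λ₁`, no estimate at the toron core):
* (companion `QuantileBitPurityBitPersistence`, ★ `bit_one_step_ge`) — PERSISTENCE of the quantile bit `O_c = 1 − 2·𝟙{polDist ≤ c}` on the ring of
  `L` transfer kernels: a Lévy bound `weight{|polDist − c| ≤ β^{−γ}} ≤ β^{−a} Z` gives `I_1 = Tr(O T O T^{L−1}) ≥ (1 − 3β^{−a}) Z`;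
* ★ `quantileBitDoor_proof` — the QUANTILE: on the `β^{−γ}`-grid above the core scale `β^{−γc}` the slice weight `F(c) = weight{polDist ≤ c}` first
  reaches `θ Z`, `θ = (1 + q⁺)/2`, at some `c` with `θ Z ≤ F(c) < (θ + β^{−a₀}) Z` (X1 at the core scale, X2 at the centre `c`); then tangent-line JENSEN
  on pairs of levels (`I_m Z^{m−1} ≥ I_1^m`, `m = ⌊L/2⌋`, so `I_m ≥ (1 − 1.5 β^{−a₀/2}) Z` on `L ≤ β^{a₀/2}`) against the LEVEL SPLIT of `I_m`
  (`ring_levels`: `I_m ≤ max(F(c), Z − F(c)) + (Z − λ_0^L)(1 + 2β^{(L−m)/L}) + 2λ_0^L β^{−m/L}`, scale `σ = β^{1/L}`) forces `Z − λ_0^L ≥ β^{−1} Z` for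
  `β ≥ (8/(1−θ))^{1/e}`, `e = min(a₀/2, 1/3)`, whence `Z_phys(2L) ≤ λ_0^L Z_phys(L) ≤ (1 − β^{−1}) Z_phys(L)²`.

HONEST FRAMING: a reduction (door) between fixed-lattice statements of a DRAFT line; the cruxes `HolonomyQuantileOffCore` (L) and `HolonomyLevyWindow` (M)
and the residual tail are NOT proved here; no summit / rung statement is proved; the YM mass gap is NOT proved.  No `sorry`, no new axiom, no new
definition.  References: [cite: MadrasSokal1988, §2]; [cite: ReedSimonIV1978, Thm. XIII.1]; [cite: MontvayMunster1994, (3.145)]; [cite: Luscher1983, §2];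
[cite: SeilerLNP1982, §3].
-/

set_option autoImplicit false

noncomputable section

open MeasureTheory Filter Topology Real Function
open scoped Matrix ComplexConjugate BigOperators
open Literature.MathematicalPhysics.QuantumLattice
open Literature.MathematicalPhysics.QuantumFieldTheory hiding SU2
open Summit.QuantumFields.YangMills.Theorems

namespace Summit.QuantumFields.YangMills.Theorems.QuantileBitPurity

open Summit.QuantumFields.YangMills.Theorems.FemtoTransferGap
open Summit.QuantumFields.YangMills.Theorems.FemtoTransferGap.FlatSheet
open Summit.QuantumFields.YangMills.Theorems.FemtoTransferGap.TT

/-! ## The door -/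

set_option maxHeartbeats 1600000 in
/-- ★ **`QuantileBitDoor` holds** (item stmt-QuantumFields-23925 of route `QuantileBitPurity`): `HolonomyQuantileOffCore → HolonomyLevyWindow →
∃ a > 0, ∃ k β₀ L₀, ∀ β ≥ β₀, ∀ L₀ ≤ L ≤ β^a, Z_phys(2L×L³) ≤ (1 − β^{−k}) Z_phys(L×L³)²`, with `k = 1` and `a = min(a₁, a₀/2)`.  A quantile of the
Polyakov holonomy off the core scale (X1) and Lévy anti-concentration above it (X2) put a `±1` QUANTILE BIT `O_c` with non-extreme thermal weights
(`θ Z ≤ weight{polDist ≤ c} < (θ + β^{−a₀}) Z`, `θ = (1 + q⁺)/2 < 1`) on the window; persistence (`bit_one_step_ge`) and tangent-line Jensen give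
`Tr(O T^m O T^{L−m}) ≥ (1 − 1.5β^{−a₀/2}) Z`, while the level split (`ring_levels`) bounds the same trace by `(θ + β^{−a₀}) Z + 3(Z − λ_0^L)β^{2/3} + 2Zβ^{−1/3}`
when `Z − λ_0^L < β^{−1} Z` — impossible for `β ≥ β₀`; hence `λ_0^L ≤ (1 − β^{−1}) Z` and `Z_phys(2L) ≤ λ_0^L Z ≤ (1 − β^{−1}) Z²`.  No entropy factor, no
`λ₁`, no estimate at the toron core.  The cruxes X1, X2 are hypotheses; nothing about the YM mass gap is proved.
[cite: MadrasSokal1988, §2] [cite: ReedSimonIV1978, Thm. XIII.1] [cite: MontvayMunster1994, (3.145)] [cite: Luscher1983, §2] -/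
theorem quantileBitDoor_proof : Summit.QuantumFields.YangMills.Theses.QuantileBitPurity.QuantileBitDoor := by
  intro hX1 hX2
  obtain ⟨γc, -, hγc5, q, hq1, a₁, ha₁, β₁, L₁, h1⟩ := hX1
  obtain ⟨a₀, ha₀, ha₀1, h2'⟩ := hX2 γc hγc5
  obtain ⟨γ, hγ, β₂, L₂, h2⟩ := h2' a₀ ha₀ le_rfl
  obtain ⟨βP, hβP9, hP⟩ := bit_one_step_ge ha₀ ha₀1 hγ
  -- constants
  set q' : ℝ := max q 0 with hq'
  set θ : ℝ := (1 + q') / 2 with hθ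
  set g : ℝ := (1 - q') / 2 with hg
  have hq'0 : 0 ≤ q' := le_max_right _ _
  have hq'1 : q' < 1 := max_lt hq1 one_pos
  have hg0 : 0 < g := by rw [hg]; linarith
  have hθg : θ = 1 - g := by rw [hθ, hg]; ring
  have hθhalf : 1 / 2 ≤ θ := by rw [hθ]; linarith
  have hθ1 : θ ≤ 1 := by rw [hθ]; linarith
  set ex : ℝ := min (a₀ / 2) (1 / 3) with hex
  have hex0 : 0 < ex := lt_min (by linarith) (by norm_num)
  set βg : ℝ := (8 / g) ^ (1 / ex) with hβg
  set a : ℝ := min a₁ (a₀ / 2) with hadef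
  have ha : 0 < a := lt_min ha₁ (by linarith)
  refine ⟨a, ha, 1, max (max (max β₁ β₂) (max βP 2)) βg, max (max L₁ L₂) 3, fun β hβ L _ hL hLβ => ?_⟩
  -- thresholds
  have hββ₁ : β₁ ≤ β := (((le_max_left _ _).trans (le_max_left _ _)).trans (le_max_left _ _)).trans hβ
  have hββ₂ : β₂ ≤ β := (((le_max_right _ _).trans (le_max_left _ _)).trans (le_max_left _ _)).trans hβ
  have hββP : βP ≤ β := (((le_max_left _ _).trans (le_max_right _ _)).trans (le_max_left _ _)).trans hβ
  have hββg : βg ≤ β := (le_max_right _ _).trans hβ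
  have hβ9 : 9 ≤ β := hβP9.trans hββP
  have hβ1 : 1 ≤ β := by linarith
  have hβ0 : 0 < β := by linarith
  -- `β^{-x} ≤ β^{-e}` for `e ≤ x`
  have rpow_neg_le_rpow_neg : ∀ {e x : ℝ}, e ≤ x → β ^ (-x) ≤ β ^ (-e) := fun h =>
    Real.rpow_le_rpow_of_exponent_le hβ1 (neg_le_neg h)
  have hLL₁ : L₁ ≤ L := ((le_max_left _ _).trans (le_max_left _ _)).trans hL
  have hLL₂ : L₂ ≤ L := ((le_max_right _ _).trans (le_max_left _ _)).trans hL
  have hL3 : 3 ≤ L := (le_max_right _ _).trans hL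
  obtain ⟨n, rfl⟩ : ∃ n, L = n + 1 := ⟨L - 1, by omega⟩
  have hn2 : 2 ≤ n := by omega
  -- the windows of the two hypotheses
  have hLa₁ : ((n + 1 : ℕ) : ℝ) ≤ β ^ a₁ := hLβ.trans (Real.rpow_le_rpow_of_exponent_le hβ1 (min_le_left _ _))
  have hLah : ((n + 1 : ℕ) : ℝ) ≤ β ^ (a₀ / 2) := hLβ.trans (Real.rpow_le_rpow_of_exponent_le hβ1 (min_le_right _ _))
  have hLa₀ : ((n + 1 : ℕ) : ℝ) ≤ β ^ a₀ := hLah.trans (Real.rpow_le_rpow_of_exponent_le hβ1 (by linarith))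
  -- the small quantities
  have hexp_e : β ^ (-ex) ≤ g / 8 := by
    -- past the threshold `β ≥ (8/g)^{1/ex}`
    have h8g : 0 < 8 / g := by positivity
    have hthr : 0 < (8 / g) ^ (1 / ex) := Real.rpow_pos_of_pos h8g _
    have hββg' : (8 / g) ^ (1 / ex) ≤ β := by rw [hβg] at hββg; exact hββg
    have h1 : (8 / g) ≤ β ^ ex := by
      have h := Real.rpow_le_rpow hthr.le hββg' hex0.le
      rwa [← Real.rpow_mul h8g.le, show 1 / ex * ex = 1 by field_simp, Real.rpow_one] at h
    rw [Real.rpow_neg hβ0.le]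
    calc (β ^ ex)⁻¹ ≤ (8 / g)⁻¹ := inv_anti₀ h8g h1
      _ = g / 8 := by rw [inv_div]
  have hεa : β ^ (-a₀) ≤ g / 8 := (rpow_neg_le_rpow_neg (by rw [hex]; exact (min_le_left _ _).trans (by linarith))).trans hexp_e
  have hεah : β ^ (-(a₀ / 2)) ≤ g / 8 := (rpow_neg_le_rpow_neg (min_le_left _ _)).trans hexp_e
  have hε3 : β ^ (-(1 / 3 : ℝ)) ≤ g / 8 := (rpow_neg_le_rpow_neg (min_le_right _ _)).trans hexp_e
  have hε1 : β⁻¹ ≤ β ^ (-(1 / 3 : ℝ)) := by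
    rw [← Real.rpow_neg_one]; exact rpow_neg_le_rpow_neg (by norm_num)
  have hεa0 : 0 ≤ β ^ (-a₀) := Real.rpow_nonneg hβ0.le _
  have hεah0 : 0 ≤ β ^ (-(a₀ / 2)) := Real.rpow_nonneg hβ0.le _
  have hε30 : 0 ≤ β ^ (-(1 / 3 : ℝ)) := Real.rpow_nonneg hβ0.le _
  have hg1 : g ≤ 1 / 2 := by rw [hg]; linarith
  -- `Z` and its positivity
  set Z : ℝ := physTrace (n + 1) β (n + 1) with hZ
  have hZdef : physTraceSucc (n + 1) β n = Z := rfl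
  have hZS := traceFormula (n + 1) β (n + 1) hβ1 (by omega)
  have hlamZ' : levelValue su2Rep (n + 1) β 0 ^ (n + 1) ≤ Z := le_hasSum hZS 0 fun k _ => pow_nonneg (levelValue_su2Rep_pos hβ0 k).le _
  have hZpos : 0 < Z := lt_of_lt_of_le (pow_pos (levelValue_zero_su2Rep_pos (n + 1) β) _) hlamZ'
  -- the slice weights `W(S)` and `F(c) = W{polDist ≤ c}`
  set F : ℝ → ℝ := fun c => ringInsTrace (n + 1) β n ({U : GaugeConfig 3 (n + 1) SU2 | polDist U ≤ c}.indicator fun _ => (1 : ℝ)) 0 with hF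
  -- X1 at the core scale, X2 at every centre above it
  have hX1' : F (β ^ (-γc)) ≤ q' * Z := by
    have h := h1 β hββ₁ (n + 1) hLL₁ hLa₁
    rw [Nat.add_sub_cancel] at h
    exact h.trans (mul_le_mul_of_nonneg_right (le_max_left _ _) hZpos.le)
  have hX2' : ∀ c : ℝ, β ^ (-γc) ≤ c →
      ringInsTrace (n + 1) β n ({U : GaugeConfig 3 (n + 1) SU2 | |polDist U - c| ≤ β ^ (-γ)}.indicator fun _ => (1 : ℝ)) 0 ≤ β ^ (-a₀) * Z := by
    intro c hc
    have h := h2 β hββ₂ (n + 1) hLL₂ hLa₀ c hc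
    rw [Nat.add_sub_cancel] at h
    exact h
  -- the grid: `x₀ = β^{-γc}`, step `h = β^{-γ}`, `K = ⌈2/h⌉`
  set x₀ : ℝ := β ^ (-γc) with hx₀
  set hh : ℝ := β ^ (-γ) with hhh
  have hh0 : 0 < hh := Real.rpow_pos_of_pos hβ0 _
  have hx₀0 : 0 < x₀ := Real.rpow_pos_of_pos hβ0 _
  set K : ℕ := ⌈2 / hh⌉₊ with hK
  have hF0 : F x₀ < θ * Z := by
    have hθq : q' < θ := by rw [hθ]; linarith
    exact lt_of_le_of_lt hX1' (mul_lt_mul_of_pos_right hθq hZpos)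
  have hFK : θ * Z ≤ F (x₀ + K * hh) := by
    have huniv : {U : GaugeConfig 3 (n + 1) SU2 | polDist U ≤ x₀ + K * hh} = Set.univ := by
      refine Set.eq_univ_of_forall fun U => ?_
      show polDist U ≤ x₀ + K * hh
      have h2 : (2 : ℝ) ≤ K * hh := by
        have hK' : 2 / hh ≤ (K : ℝ) := Nat.le_ceil _
        have := mul_le_mul_of_nonneg_right hK' hh0.le
        rwa [div_mul_cancel₀ _ hh0.ne'] at this
      linarith [polDist_le_two U]
    have hval : F (x₀ + K * hh) = Z := by
      simp only [hF]
      rw [huniv, Set.indicator_univ, ringInsTrace_const_one, hZdef]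
    rw [hval]
    exact (mul_le_mul_of_nonneg_right hθ1 hZpos.le).trans_eq (one_mul Z)
  obtain ⟨i, hi1, -, hlt, hge⟩ := exists_grid_crossing F x₀ hh (θ * Z) hF0 hFK
  set c : ℝ := x₀ + i * hh with hcdef
  set c' : ℝ := x₀ + ((i - 1 : ℕ) : ℝ) * hh with hc'def
  have hcc' : c = c' + hh := by
    rw [hcdef, hc'def]
    have : ((i : ℕ) : ℝ) = ((i - 1 : ℕ) : ℝ) + 1 := by
      rw [Nat.cast_sub hi1]; push_cast; ring
    rw [this]; ring
  have hc_ge : β ^ (-γc) ≤ c := by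
    rw [hcdef]
    have : 0 ≤ (i : ℝ) * hh := by positivity
    linarith
  -- `θ Z ≤ F c < (θ + β^{-a₀}) Z`
  have hAc : MeasurableSet {U : GaugeConfig 3 (n + 1) SU2 | polDist U ≤ c} := measurableSet_polDist_le c
  have hAc' : MeasurableSet {U : GaugeConfig 3 (n + 1) SU2 | polDist U ≤ c'} := measurableSet_polDist_le c'
  have hNc : MeasurableSet {U : GaugeConfig 3 (n + 1) SU2 | |polDist U - c| ≤ hh} := measurableSet_polDist_near c hh
  have hFc_lt : F c < (θ + β ^ (-a₀)) * Z := by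
    have hsub : {U : GaugeConfig 3 (n + 1) SU2 | polDist U ≤ c} ⊆
        {U : GaugeConfig 3 (n + 1) SU2 | polDist U ≤ c'} ∪ {U : GaugeConfig 3 (n + 1) SU2 | |polDist U - c| ≤ hh} := by
      intro U hU
      have hU' : polDist U ≤ c := hU
      by_cases hU2 : polDist U ≤ c'
      · exact Or.inl hU2
      · right
        show |polDist U - c| ≤ hh
        rw [abs_le]; constructor <;> linarith [not_le.1 hU2]
    have hm := ringInsTrace_indicator_zero_mono hβ0.le n hAc (hAc'.union hNc) hsub
    have hu := ringInsTrace_indicator_zero_union_le hβ0.le n hAc' hNc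
    have hx := hX2' c hc_ge
    have hlt' : F c' < θ * Z := hlt
    calc F c ≤ F c' + ringInsTrace (n + 1) β n ({U : GaugeConfig 3 (n + 1) SU2 | |polDist U - c| ≤ hh}.indicator fun _ => (1 : ℝ)) 0 :=
          hm.trans hu
      _ < θ * Z + β ^ (-a₀) * Z := add_lt_add_of_lt_of_le hlt' hx
      _ = (θ + β ^ (-a₀)) * Z := by ring
  have hFc_ge : θ * Z ≤ F c := hge
  -- the complementary weight
  have hcompl : F c + ringInsTrace (n + 1) β n ({U : GaugeConfig 3 (n + 1) SU2 | polDist U ≤ c}ᶜ.indicator fun _ => (1 : ℝ)) 0 = Z := by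
    rw [← hZdef]; exact ringInsTrace_indicator_zero_add_compl hβ0.le n hAc
  have hmaxW : max (ringInsTrace (n + 1) β n ({U : GaugeConfig 3 (n + 1) SU2 | polDist U ≤ c}.indicator fun _ => (1 : ℝ)) 0)
      (ringInsTrace (n + 1) β n ({U : GaugeConfig 3 (n + 1) SU2 | polDist U ≤ c}ᶜ.indicator fun _ => (1 : ℝ)) 0) ≤ (θ + β ^ (-a₀)) * Z := by
    refine max_le hFc_lt.le ?_
    have h1 : ringInsTrace (n + 1) β n ({U : GaugeConfig 3 (n + 1) SU2 | polDist U ≤ c}ᶜ.indicator fun _ => (1 : ℝ)) 0 = Z - F c := by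
      linarith [hcompl]
    rw [h1]
    have h2 : (1 - θ) * Z ≤ θ * Z := mul_le_mul_of_nonneg_right (by linarith) hZpos.le
    have h3 : 0 ≤ β ^ (-a₀) * Z := mul_nonneg hεa0 hZpos.le
    nlinarith [hFc_ge, h2, h3]
  -- the bit, persistence
  set O : GaugeConfig 3 (n + 1) SU2 → ℝ := fun U => 1 - 2 * {U : GaugeConfig 3 (n + 1) SU2 | polDist U ≤ c}.indicator (fun _ => (1 : ℝ)) U
    with hO
  have hOP : IsPhys O := isPhys_bit c
  have hI1 : (1 - 3 * β ^ (-a₀)) * Z ≤ ringInsTrace (n + 1) β n O 1 := hP β hββP n (by omega) hLa₀ c (hX2' c hc_ge)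
  -- the levels: Jensen and split at `m = ⌊(n+1)/2⌋`, scale `σ = β^{1/(n+1)}`
  set m : ℕ := (n + 1) / 2 with hmdef
  have hm1 : 1 ≤ m := by omega
  have hm2 : m + 1 ≤ n := by omega
  have h2m : 2 * m ≤ n + 1 := by omega
  have h3m : n + 1 ≤ 3 * m := by omega
  have hNpos : (0 : ℝ) < ((n + 1 : ℕ) : ℝ) := by positivity
  set σ : ℝ := β ^ ((1 : ℝ) / ((n + 1 : ℕ) : ℝ)) with hσdef
  have hσ0 : 0 < σ := Real.rpow_pos_of_pos hβ0 _
  have hσ1 : 1 ≤ σ := Real.one_le_rpow hβ1 (by positivity)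
  obtain ⟨hJ, hS, hlamZ, hdouble, hlam0⟩ := ring_levels hβ1 hm1 hm2 hAc (isPhys_indicator_polDist_le c) (isPhys_indicator_polDist_le_compl c)
    hOP (bit_eq_indicator_sub c) hσ0
  set p : ℝ := levelValue su2Rep (n + 1) β 0 ^ (n + 1) with hpdef
  have hp0 : 0 ≤ p := pow_nonneg hlam0.le _
  set Im : ℝ := ringInsTrace (n + 1) β n O m with hImdef
  set I1 : ℝ := ringInsTrace (n + 1) β n O 1 with hI1def
  -- (a) `I_m ≥ (1 − 1.5 β^{-a₀/2}) Z`
  set δ : ℝ := 3 * β ^ (-a₀) with hδ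
  have hδ0 : 0 ≤ δ := by positivity
  have hδ1 : δ ≤ 1 := by rw [hδ]; linarith
  have hI1_0 : 0 ≤ I1 := le_trans (mul_nonneg (by linarith) hZpos.le) hI1
  have hIm_ge : (1 - (m : ℝ) * δ) * Z ≤ Im := by
    -- `((1-δ) Z)^m ≤ I1^m ≤ Im Z^{m-1}`
    have h1 : ((1 - δ) * Z) ^ m ≤ Im * Z ^ (m - 1) := (pow_le_pow_left₀ (mul_nonneg (by linarith) hZpos.le) hI1 m).trans hJ
    have hZm : Z ^ m = Z * Z ^ (m - 1) := by rw [← pow_succ']; congr 1; omega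
    rw [mul_pow, hZm, ← mul_assoc] at h1
    have h2 : (1 - δ) ^ m * Z ≤ Im := le_of_mul_le_mul_right h1 (pow_pos hZpos _)
    have hB : 1 - (m : ℝ) * δ ≤ (1 - δ) ^ m := by
      have h := one_add_mul_le_pow (show (-2 : ℝ) ≤ -δ by linarith) m
      have e1 : 1 + (m : ℝ) * -δ = 1 - (m : ℝ) * δ := by ring
      have e2 : (1 + -δ) = 1 - δ := by ring
      rw [e1, e2] at h; exact h
    exact (mul_le_mul_of_nonneg_right hB hZpos.le).trans h2
  have hmδ : (m : ℝ) * δ ≤ 3 / 2 * β ^ (-(a₀ / 2)) := by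
    have hmle : (m : ℝ) ≤ ((n + 1 : ℕ) : ℝ) / 2 := by
      rw [le_div_iff₀ (by norm_num : (0 : ℝ) < 2)]; exact_mod_cast (by omega : m * 2 ≤ n + 1)
    have hmle2 : (m : ℝ) ≤ β ^ (a₀ / 2) / 2 := hmle.trans (by linarith)
    have hprod : β ^ (a₀ / 2) * β ^ (-a₀) = β ^ (-(a₀ / 2)) := by
      rw [← Real.rpow_add hβ0]; congr 1; ring
    calc (m : ℝ) * δ ≤ β ^ (a₀ / 2) / 2 * δ := mul_le_mul_of_nonneg_right hmle2 hδ0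
      _ = 3 / 2 * (β ^ (a₀ / 2) * β ^ (-a₀)) := by rw [hδ]; ring
      _ = 3 / 2 * β ^ (-(a₀ / 2)) := by rw [hprod]
  have hIm_ge' : (1 - 3 / 2 * β ^ (-(a₀ / 2))) * Z ≤ Im :=
    (mul_le_mul_of_nonneg_right (by linarith) hZpos.le).trans hIm_ge
  -- (b) the key claim: `β⁻¹ Z ≤ Z − λ₀^{n+1}`
  have hσA : σ ^ (n + 1 - m) = β ^ (((n + 1 - m : ℕ) : ℝ) / ((n + 1 : ℕ) : ℝ)) := by
    rw [hσdef, ← Real.rpow_natCast, ← Real.rpow_mul hβ0.le]; congr 1; field_simp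
  have hσB : σ ^ m = β ^ ((m : ℝ) / ((n + 1 : ℕ) : ℝ)) := by
    rw [hσdef, ← Real.rpow_natCast, ← Real.rpow_mul hβ0.le]; congr 1; field_simp
  have hmN : (1 / 3 : ℝ) ≤ (m : ℝ) / ((n + 1 : ℕ) : ℝ) := by
    rw [div_le_div_iff₀ (by norm_num) hNpos]; norm_cast; omega
  have hAm : (m : ℝ) / ((n + 1 : ℕ) : ℝ) ≤ ((n + 1 - m : ℕ) : ℝ) / ((n + 1 : ℕ) : ℝ) := by
    refine div_le_div_of_nonneg_right ?_ hNpos.le; norm_cast; omega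
  have hinvB : (σ ^ m)⁻¹ ≤ β ^ (-(1 / 3 : ℝ)) := by
    rw [hσB, ← Real.rpow_neg hβ0.le]; exact rpow_neg_le_rpow_neg hmN
  have hinvA : (σ ^ (n + 1 - m))⁻¹ ≤ β ^ (-(1 / 3 : ℝ)) := by
    rw [hσA, ← Real.rpow_neg hβ0.le]; exact rpow_neg_le_rpow_neg (hmN.trans hAm)
  have hσAB : σ ^ m ≤ σ ^ (n + 1 - m) := pow_le_pow_right₀ hσ1 (by omega)
  have hσA1 : β⁻¹ * σ ^ (n + 1 - m) ≤ β ^ (-(1 / 3 : ℝ)) := by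
    rw [hσA, ← Real.rpow_neg_one, ← Real.rpow_add hβ0]
    refine (Real.rpow_le_rpow_of_exponent_le hβ1 ?_).trans (le_refl _) |>.trans (rpow_neg_le_rpow_neg hmN)
    -- `-1 + (n+1-m)/(n+1) = -(m/(n+1))`
    have e : (-1 : ℝ) + ((n + 1 - m : ℕ) : ℝ) / ((n + 1 : ℕ) : ℝ) = -((m : ℝ) / ((n + 1 : ℕ) : ℝ)) := by
      rw [Nat.cast_sub (by omega : m ≤ n + 1)]
      field_simp
      ring
    rw [e]
  have hkey : β⁻¹ * Z ≤ Z - p := by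
    by_contra hcon
    have hE : Z - p < β⁻¹ * Z := not_le.1 hcon
    have hE0 : 0 ≤ Z - p := by linarith [hlamZ]
    -- the split bound under `Z − p < β⁻¹ Z`
    have hb1 : (Z - p) * (1 + σ ^ (n + 1 - m) + σ ^ m) ≤ 3 * β ^ (-(1 / 3 : ℝ)) * Z := by
      have h1 : (Z - p) * σ ^ (n + 1 - m) ≤ β ^ (-(1 / 3 : ℝ)) * Z := by
        calc (Z - p) * σ ^ (n + 1 - m) ≤ β⁻¹ * Z * σ ^ (n + 1 - m) := mul_le_mul_of_nonneg_right hE.le (by positivity)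
          _ = β⁻¹ * σ ^ (n + 1 - m) * Z := by ring
          _ ≤ β ^ (-(1 / 3 : ℝ)) * Z := mul_le_mul_of_nonneg_right hσA1 hZpos.le
      have h2 : (Z - p) * σ ^ m ≤ β ^ (-(1 / 3 : ℝ)) * Z := (mul_le_mul_of_nonneg_left hσAB hE0).trans h1
      have h3 : (Z - p) * 1 ≤ β ^ (-(1 / 3 : ℝ)) * Z := by
        rw [mul_one]; exact hE.le.trans (mul_le_mul_of_nonneg_right hε1 hZpos.le)
      have e : (Z - p) * (1 + σ ^ (n + 1 - m) + σ ^ m) = (Z - p) * 1 + (Z - p) * σ ^ (n + 1 - m) + (Z - p) * σ ^ m := by ring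
      rw [e]; linarith [h1, h2, h3]
    have hb2 : p * ((σ ^ (n + 1 - m))⁻¹ + (σ ^ m)⁻¹) ≤ 2 * β ^ (-(1 / 3 : ℝ)) * Z := by
      have h1 : p * (σ ^ (n + 1 - m))⁻¹ ≤ Z * β ^ (-(1 / 3 : ℝ)) := mul_le_mul hlamZ hinvA (by positivity) hZpos.le
      have h2 : p * (σ ^ m)⁻¹ ≤ Z * β ^ (-(1 / 3 : ℝ)) := mul_le_mul hlamZ hinvB (by positivity) hZpos.le
      rw [mul_add]; linarith [h1, h2]
    have hup : Im ≤ (θ + β ^ (-a₀)) * Z + 3 * β ^ (-(1 / 3 : ℝ)) * Z + 2 * β ^ (-(1 / 3 : ℝ)) * Z := by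
      linarith [hS, hmaxW, hb1, hb2]
    -- compare with the lower bound and divide by `Z`
    have hcmp : (1 - 3 / 2 * β ^ (-(a₀ / 2))) * Z ≤ (θ + β ^ (-a₀) + 5 * β ^ (-(1 / 3 : ℝ))) * Z := by
      have e : (θ + β ^ (-a₀) + 5 * β ^ (-(1 / 3 : ℝ))) * Z =
          (θ + β ^ (-a₀)) * Z + 3 * β ^ (-(1 / 3 : ℝ)) * Z + 2 * β ^ (-(1 / 3 : ℝ)) * Z := by ring
      rw [e]; exact hIm_ge'.trans hup
    have hcmp' : 1 - 3 / 2 * β ^ (-(a₀ / 2)) ≤ θ + β ^ (-a₀) + 5 * β ^ (-(1 / 3 : ℝ)) := le_of_mul_le_mul_right hcmp hZpos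
    rw [hθg] at hcmp'
    linarith [hcmp', hεa, hεah, hε3, hg0]
  -- (c) conclusion: `Z(2L) ≤ λ₀^L Z ≤ (1 − β⁻¹) Z²`
  have hpZ : p ≤ (1 - β⁻¹) * Z := by linarith [hkey]
  rw [Real.rpow_neg_one]
  calc physTrace (n + 1) β (2 * (n + 1)) ≤ p * Z := hdouble
    _ ≤ (1 - β⁻¹) * Z * Z := mul_le_mul_of_nonneg_right hpZ hZpos.le
    _ = (1 - β⁻¹) * Z ^ 2 := by ring

end Summit.QuantumFields.YangMills.Theorems.QuantileBitPurity

end
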